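import Summits.KontsevichZagierPeriods.KontsevichZagierPeriods.Theses.FurushoPentagon
import Summits.KontsevichZagierPeriods.KontsevichZagierPeriods.Theorems.StuffleInKZ.Negative.LoadBearing
import Summits.KontsevichZagierPeriods.KontsevichZagierPeriods.Theorems.StuffleInKZ.Negative.NewtonLeibnizFree
import Summits.KontsevichZagierPeriods.KontsevichZagierPeriods.Theorems.StuffleInKZ.Negative.ChangeOfVariablesFree
import Summits.KontsevichZagierPeriods.KontsevichZagierPeriods.Theorems.HoffmanRelationInKZ.Negative.HoffmanElement
import Literature.NumberTheory.Transcendental.KZKernelConjectureForms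
import Literature.Barriers.KontsevichZagierPeriods.GrothendieckPeriodConjectureDependenceOddZetaProofs

/-!
# `SectorToKernel` (stmt-KontsevichZagierPeriods-10813), negative side — anatomy of the crux

Route FurushoPentagon's complement item
`SectorToKernel : StuffleInKZ → HoffmanRelationInKZ → ∀ c, KZ.eval c = 0 → c ∈ KZ.relations`.
Landed form of the crux disprover's `Cruxes/SectorToKernel/Disproof.lean` (cycle 1), importable by planners,
ideators and provers. Theorems only; no definition, no statement change, no named fact.

* The conclusion is verbatim `KZKernelConjecture`, i.e. Conjecture 1 (`kzKernelConjecture_iff_isRational`).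
* The hypotheses are consequences of the conclusion (`hyps_of_kzKernelConjecture`, from the sibling lanes
  `StuffleInKZ.Negative.stuffleInKZ_of_kernel` and `HoffmanRelationInKZ.Negative.of_kernelForm`).
* Hence `SectorToKernel ↔ K ∨ ¬S ∨ ¬H` and **`¬SectorToKernel ↔ S ∧ H ∧ ¬KontsevichZagierPeriods`**: a
  refutation is a disproof of the summit together with proofs of both open cruxes; a proof, together with
  proofs of both cruxes, is a proof of the summit (`sectorToKernel_iff_summit_of_hyps`, `cases_complete`).
  Each vacuity escape `¬S` / `¬H` is itself a disproof of the summit (siblings'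
  `StuffleInKZ.Negative.not_summit_of_not_stuffleInKZ`, `HoffmanRelationInKZ.Negative.not_summit_of_not`).
* No `_false_without_` theorem for either hypothesis exists unless Conjecture 1 is false
  (`not_summit_of_not_withoutStuffle`, `not_summit_of_not_withoutHoffman`, `not_kzKernelConjecture_iff`).
* Natural strengthenings refuted: the kernel form is FALSE for each proper sub-calculus — Stokes-free and
  change-of-variables-free by the sibling lane (`StuffleInKZ.Negative.not_kernel_le_nlFree`,
  `StuffleInKZ.Negative.not_kernel_le_covFree`), additivity-free here (`kernelForm_false_covNL`); so the three
  weakened cruxes "S → H → (ker eval ⊆ sub-closure)" fail as soon as S and H hold (`not_weakSector_of_hyps`).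
* Barrier positioning: modulo the catalogued fact `kzConjecture_implies_oddZetaAlgIndep`, crux + S + H would
  prove `ζ(5) ∉ ℚ` (contrapositive `not_sectorToKernel_of_not_zetaFiveIrrational`).
-/

noncomputable section

namespace Summit.KontsevichZagierPeriods.SectorToKernel.Negative

open MeasureTheory Set
open Literature.NumberTheory.Transcendental
open Literature.NumberTheory.Transcendental.KZ
open Summit.KontsevichZagierPeriods.KontsevichZagierPeriods.Theses.FurushoPentagon

open Summit.KontsevichZagierPeriods.Theorems.StuffleInKZ.Negative (stuffleInKZ_of_kernel
  not_summit_of_not_stuffleInKZ covNLRelations covNLRelations_le_ker_aug aug aug_of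
  nlFreeRelations not_kernel_le_nlFree covFreeRelations not_kernel_le_covFree)

/-! ## Unfolding -/

/-- The crux, unfolded: its conclusion is verbatim the conjecture leaf `KZKernelConjecture`. [folklore] -/
theorem sectorToKernel_iff :
    SectorToKernel ↔ (StuffleInKZ → HoffmanRelationInKZ → KZKernelConjecture) := Iff.rfl

/-- The conclusion is Conjecture 1 (tree theorem `kzKernelConjecture_iff_isRational`). [folklore] -/
theorem kzKernelConjecture_iff_summit : KZKernelConjecture ↔ KontsevichZagierPeriods :=
  kzKernelConjecture_iff_isRational.trans KontsevichZagierPeriods_iff.symm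

/-! ## The hypotheses are consequences of the conclusion -/

/-- **`K ⇒ StuffleInKZ ∧ HoffmanRelationInKZ`** (both defects evaluate to `0`: Hoffman 1997 Thm 4.2,
Hoffman 1992 Thm 5.1, Kontsevich's formula — all tree theorems — and `K` puts `ker eval` in `relations`).
[folklore] -/
theorem hyps_of_kzKernelConjecture (h : KZKernelConjecture) : StuffleInKZ ∧ HoffmanRelationInKZ :=
  ⟨stuffleInKZ_of_kernel h, Summit.KontsevichZagierPeriods.HoffmanRelationInKZ.Negative.of_kernelForm h⟩

/-! ## Anatomy -/

/-- **`SectorToKernel ↔ K ∨ ¬S ∨ ¬H`.** [folklore] -/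
theorem sectorToKernel_iff_or :
    SectorToKernel ↔ (KZKernelConjecture ∨ ¬ StuffleInKZ ∨ ¬ HoffmanRelationInKZ) := by
  constructor
  · intro h
    by_cases hS : StuffleInKZ
    · by_cases hH : HoffmanRelationInKZ
      · exact Or.inl (h hS hH)
      · exact Or.inr (Or.inr hH)
    · exact Or.inr (Or.inl hS)
  · rintro (hK | hS | hH)
    · exact fun _ _ => hK
    · exact fun hS' _ => absurd hS' hS
    · exact fun _ hH' => absurd hH' hH

/-- **`¬SectorToKernel ↔ S ∧ H ∧ ¬K`.** [folklore] -/
theorem not_sectorToKernel_iff :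
    ¬ SectorToKernel ↔ (StuffleInKZ ∧ HoffmanRelationInKZ ∧ ¬ KZKernelConjecture) := by
  constructor
  · intro h
    by_cases hS : StuffleInKZ
    · by_cases hH : HoffmanRelationInKZ
      · exact ⟨hS, hH, fun hK => h fun _ _ => hK⟩
      · exact absurd (fun _ hH' => absurd hH' hH) h
    · exact absurd (fun hS' _ => absurd hS' hS) h
  · rintro ⟨hS, hH, hK⟩ h
    exact hK (h hS hH)

/-- **`¬SectorToKernel ↔ S ∧ H ∧ ¬KontsevichZagierPeriods`**: a refutation of the crux is a disproof of
Conjecture 1 together with proofs of both open cruxes `StuffleInKZ`, `HoffmanRelationInKZ`. [folklore] -/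
theorem not_sectorToKernel_iff_summit :
    ¬ SectorToKernel ↔ (StuffleInKZ ∧ HoffmanRelationInKZ ∧ ¬ KontsevichZagierPeriods) := by
  rw [not_sectorToKernel_iff, kzKernelConjecture_iff_summit]

/-- A kill of the crux is a kill of the summit. [folklore] -/
theorem not_summit_of_not_sectorToKernel (h : ¬ SectorToKernel) : ¬ KontsevichZagierPeriods :=
  (not_sectorToKernel_iff_summit.mp h).2.2

/-- **Given its hypotheses the crux IS Conjecture 1** — the residual claim of route FurushoPentagon once its
mechanism has delivered `StuffleInKZ` and `HoffmanRelationInKZ`. [folklore] -/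
theorem sectorToKernel_iff_summit_of_hyps (hS : StuffleInKZ) (hH : HoffmanRelationInKZ) :
    SectorToKernel ↔ KontsevichZagierPeriods :=
  ⟨fun h => kzKernelConjecture_iff_summit.mp (h hS hH), fun h _ _ => kzKernelConjecture_iff_summit.mpr h⟩

/-- **Complete case analysis.** Either Conjecture 1 holds and the crux with it (hypotheses idle), or
Conjecture 1 fails and the crux is exactly the statement that one of its two hypotheses fails. [folklore] -/
theorem cases_complete :
    (KontsevichZagierPeriods ∧ SectorToKernel) ∨
    (¬ KontsevichZagierPeriods ∧ (SectorToKernel ↔ ¬ (StuffleInKZ ∧ HoffmanRelationInKZ))) := by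
  by_cases hs : KontsevichZagierPeriods
  · exact Or.inl ⟨hs, fun _ _ => kzKernelConjecture_iff_summit.mpr hs⟩
  · refine Or.inr ⟨hs, ?_⟩
    rw [sectorToKernel_iff_or, kzKernelConjecture_iff_summit, not_and_or]
    constructor
    · rintro (h | h | h)
      · exact absurd h hs
      · exact Or.inl h
      · exact Or.inr h
    · rintro (h | h)
      · exact Or.inr (Or.inl h)
      · exact Or.inr (Or.inr h)

/-- A refutation exhibits an element of `ker eval ∖ relations`. [folklore] -/
theorem counterexample_shape (h : ¬ SectorToKernel) : ∃ c : FormalRep, eval c = 0 ∧ c ∉ relations := by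
  obtain ⟨-, -, hK⟩ := not_sectorToKernel_iff.mp h
  by_contra hc
  push Not at hc
  exact hK hc

/-! ## Load-bearing analysis: no `_false_without_` theorem short of `¬`Conjecture 1 -/

/-- Dropping `StuffleInKZ` cannot be shown false unless Conjecture 1 is false. [folklore] -/
theorem not_summit_of_not_withoutStuffle (h : ¬ (HoffmanRelationInKZ → KZKernelConjecture)) :
    ¬ KontsevichZagierPeriods :=
  fun hs => h fun _ => kzKernelConjecture_iff_summit.mpr hs

/-- Dropping `HoffmanRelationInKZ` cannot be shown false unless Conjecture 1 is false. [folklore] -/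
theorem not_summit_of_not_withoutHoffman (h : ¬ (StuffleInKZ → KZKernelConjecture)) :
    ¬ KontsevichZagierPeriods :=
  fun hs => h fun _ => kzKernelConjecture_iff_summit.mpr hs

/-- Dropping both hypotheses leaves exactly Conjecture 1. [folklore] -/
theorem not_kzKernelConjecture_iff : ¬ KZKernelConjecture ↔ ¬ KontsevichZagierPeriods :=
  not_congr kzKernelConjecture_iff_summit

/-- Precisely: `¬(H → K) ↔ H ∧ ¬summit` … [folklore] -/
theorem not_withoutStuffle_iff :
    ¬ (HoffmanRelationInKZ → KZKernelConjecture) ↔ (HoffmanRelationInKZ ∧ ¬ KontsevichZagierPeriods) := by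
  rw [Classical.not_imp, kzKernelConjecture_iff_summit]

/-- … and `¬(S → K) ↔ S ∧ ¬summit`. [folklore] -/
theorem not_withoutHoffman_iff :
    ¬ (StuffleInKZ → KZKernelConjecture) ↔ (StuffleInKZ ∧ ¬ KontsevichZagierPeriods) := by
  rw [Classical.not_imp, kzKernelConjecture_iff_summit]

/-! ## Natural strengthenings refuted: the kernel form fails for every proper sub-calculus -/

/-- **Additivity is necessary for the kernel form**: `ker eval ⊄ closure (2 ∪ 3)`. Witness
`[pt, 1] + [pt, −1]` (value `0`, augmentation `2`; sibling `covNLRelations_le_ker_aug`). The Stokes-free and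
CoV-free failures are the sibling lane's `not_kernel_le_nlFree`, `not_kernel_le_covFree`. [folklore] -/
theorem kernelForm_false_covNL : ¬ ∀ c : FormalRep, eval c = 0 → c ∈ covNLRelations := by
  intro h
  set c : FormalRep := of IntegralRep.unit + of IntegralRep.unit.neg with hc
  have h0 : eval c = 0 := by
    rw [hc, map_add, eval_of, eval_of, IntegralRep.value_neg, IntegralRep.value_unit, add_neg_cancel]
  have hmem := covNLRelations_le_ker_aug (h c h0)
  rw [AddMonoidHom.mem_ker, hc, map_add, aug_of, aug_of] at hmem
  norm_num at hmem

/-- Hence the three weakened cruxes "S → H → (ker eval ⊆ sub-closure)" — Stokes-free, CoV-free,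
additivity-free — are refuted as soon as the two hypotheses hold (and, like the crux, not before). [folklore] -/
theorem not_weakSector_of_hyps (hS : StuffleInKZ) (hH : HoffmanRelationInKZ) :
    ¬ (StuffleInKZ → HoffmanRelationInKZ → ∀ c : FormalRep, eval c = 0 → c ∈ nlFreeRelations) ∧
    ¬ (StuffleInKZ → HoffmanRelationInKZ → ∀ c : FormalRep, eval c = 0 → c ∈ covFreeRelations) ∧
    ¬ (StuffleInKZ → HoffmanRelationInKZ → ∀ c : FormalRep, eval c = 0 → c ∈ covNLRelations) :=
  ⟨fun h => not_kernel_le_nlFree (h hS hH), fun h => not_kernel_le_covFree (h hS hH),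
    fun h => kernelForm_false_covNL (h hS hH)⟩

/-! ## Barrier positioning -/

/-- Modulo the catalogued barrier fact `kzConjecture_implies_oddZetaAlgIndep` ("The Period Conjecture implies
that the ζ(2n+1) are algebraically independent", Huber–Wüstholz 2022, Prologue p. xvi), a proof of the crux plus
proofs of its two hypotheses would prove `ζ(5) ∉ ℚ` (open); stated contrapositively: were `ζ(5)` rational, the
crux would fail as soon as its hypotheses hold. [folklore] -/
theorem not_sectorToKernel_of_not_zetaFiveIrrational
    (hB : Literature.Barriers.KontsevichZagierPeriods.kzConjecture_implies_oddZetaAlgIndep)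
    (h5 : ¬ ZetaFiveIrrational) (hS : StuffleInKZ) (hH : HoffmanRelationInKZ) : ¬ SectorToKernel :=
  fun h => h5 (Literature.Barriers.KontsevichZagierPeriods.zetaFiveIrrational_of_kzKernel hB (h hS hH))

/-- Same with the irrationality of every `ζ(2k+1)`, `k ≥ 1` (open). [folklore] -/
theorem not_sectorToKernel_of_not_oddZetaIrrational
    (hB : Literature.Barriers.KontsevichZagierPeriods.kzConjecture_implies_oddZetaAlgIndep)
    (ho : ¬ OddZetaIrrational) (hS : StuffleInKZ) (hH : HoffmanRelationInKZ) : ¬ SectorToKernel :=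
  fun h => ho (Literature.Barriers.KontsevichZagierPeriods.oddZetaIrrational_of_kzKernel hB (h hS hH))

end Summit.KontsevichZagierPeriods.SectorToKernel.Negative
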